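/-
COR-CM (cells pub-hodgecm / pub-hodgecm2, stage 2 of the Hodge ladder) — TRANSPOSITION item (vi), Δ2-bridge AUDIT INPUT (ORIENTATION-MEMO §4,
test T2; DECISION #14 §2 (c)): NON-VACUITY OF THE BLOCKS from two hypotheses the junction already consumes.  Author item6-p3 g14
(prover-pub-hodgecm2-item6-p3-g14-0).  THEOREMS ONLY over the ABSTRACT datum `HodgeCM.Literature.Theta.LiuAlbaneseModuleDatum` (port
Literature leaf, imported, not edited): from Prop. 4.13 AS TYPED (`Prop413 : Nonempty (H ≃ₗ[ℂ[G]] ⨁ t, ω(t))`) and the non-vanishing of ONE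
summand `ω(μ,ε,χ)` (`Nontrivial`), the `μ`-block of `H` is non-zero.  In the pinned dictionary this reads: `T.Prop413` (consumed by
`HodgeCM.Model.subset_span_of_liuDictionary`) + `hnvD` (✔ `Model.nontrivial_omegaAt_restOfCharDeltaPrime_of_lemD1AsPrinted` transported by
✔ `Model.omegaTransportAtDeltaPrime`) ⇒ `block i ≠ ⊥` at EVERY good line, `PhiMu` or not — the non-vacuity witness the T2 reduction needs.
Nothing here is a claim of the manuscripts under adjudication; HC_CM is NOT proved; «Δ2 BRIDGE CLOSED» is NOT claimed; no pointer moves.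
-/
import Summits.HodgeConjecture.HodgeCM.Literature.AlbaneseUnitaryShimuraModules
import HarnessLib

/-!
# Non-vanishing of the `μ`-blocks from [Liu21, Prop. 4.13] as typed + one non-zero summand

For `D : LiuAlbaneseModuleDatum G Kof` ([Liu21] §4.2 carriers: `H = H¹_{B,τ'}(A_∞, ℂ)`, `ω(t)` the adèlic oscillator modules):

* `exists_injective_range_le_oscImage_of_prop413` — a Prop.-4.13 isomorphism `H ≃ ⨁ ω` embeds every summand `ω(t)` equivariantly
  into `H`, with range inside `oscImage t`;
* `oscImage_ne_bot_of_prop413` — `Prop413` + `Nontrivial (ω(t))` ⇒ `oscImage t ≠ ⊥`;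
* `block_ne_bot_of_prop413` — hence `block μ ≠ ⊥` as soon as one `μ`-admissible `ω(μ,ε,χ)` is non-zero;
* `exists_mem_block_ne_zero_of_prop413` — the same as an explicit non-zero vector of the block.

All proofs are Mathlib plumbing (`DirectSum.lof`, `DirectSum.of_injective`, `LinearEquiv.injective`); THEOREMS ONLY (no `def`).  HC_CM is NOT proved.
-/

set_option autoImplicit false

noncomputable section

universe u v

open DirectSum

namespace Summit.HodgeConjecture.CorCM.Transposition.BlockNonvanishing

open HodgeCM.Literature.Theta HodgeCM.Literature.Theta.LiuAlbaneseModuleDatum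

variable {G : Type u} [Group G] {Lvl : Type v} {Kof : Lvl → Subgroup G} (D : LiuAlbaneseModuleDatum G Kof)

/-- **Prop. 4.13 as typed ⇒ every summand `ω(t)` EMBEDS `ℂ[G]`-linearly into `H`** (the `t`-th summand inclusion of a decomposition
`e : H ≃ ⨁_t ω(t)`, composed with `e⁻¹`): an injective equivariant map whose range lies in `oscImage t`. [cite: Liu21, Prop. 4.13] -/
theorem exists_injective_range_le_oscImage_of_prop413 (h413 : D.Prop413) (t : D.Triple) :
    ∃ ψ : D.Ωt t →ₗ[MonoidAlgebra ℂ G] D.H,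
      Function.Injective ψ ∧ (LinearMap.range ψ).restrictScalars ℂ ≤ D.oscImage t := by
  obtain ⟨e⟩ := h413
  refine ⟨e.symm.toLinearMap ∘ₗ DirectSum.lof (MonoidAlgebra ℂ G) D.Triple (fun s => D.Ωt s) t, ?_,
    range_le_oscImage (D := D) t _⟩
  intro x y hxy
  have h : DirectSum.lof (MonoidAlgebra ℂ G) D.Triple (fun s => D.Ωt s) t x =
      DirectSum.lof (MonoidAlgebra ℂ G) D.Triple (fun s => D.Ωt s) t y :=
    e.symm.injective hxy
  rw [DirectSum.lof_eq_of, DirectSum.lof_eq_of] at h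
  exact DirectSum.of_injective t h

/-- **Prop. 4.13 as typed + one non-zero summand ⇒ the isotypic image `oscImage t` is non-zero.** [cite: Liu21, Prop. 4.13] -/
theorem oscImage_ne_bot_of_prop413 (h413 : D.Prop413) (t : D.Triple) [Nontrivial (D.Ωt t)] : D.oscImage t ≠ ⊥ := by
  obtain ⟨ψ, hψ, hrange⟩ := exists_injective_range_le_oscImage_of_prop413 D h413 t
  obtain ⟨x, hx⟩ := exists_ne (0 : D.Ωt t)
  rw [Submodule.ne_bot_iff]
  refine ⟨ψ x, hrange ⟨x, rfl⟩, ?_⟩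
  intro h0
  exact hx (hψ (by rw [h0, map_zero]))

/-- **The `μ`-block is non-zero** as soon as Prop. 4.13 (as typed) holds and ONE `μ`-admissible `ω(μ,ε,χ)` is non-zero — at every
character `μ`, whether or not `τ' ∈ Φ_μ`. [cite: Liu21, Prop. 4.13] -/
theorem block_ne_bot_of_prop413 (h413 : D.Prop413) (μ : D.Char) (a : D.Adm μ) [Nontrivial (D.Ω μ a)] : D.block μ ≠ ⊥ := by
  intro hbot
  haveI : Nontrivial (D.Ωt ⟨μ, a⟩) := ‹Nontrivial (D.Ω μ a)›
  exact oscImage_ne_bot_of_prop413 D h413 ⟨μ, a⟩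
    (le_bot_iff.1 ((oscImage_le_block (D := D) ⟨μ, a⟩).trans (le_of_eq hbot)))

/-- The same as an explicit witness: a non-zero vector of `block μ` in the equivariant image of `ω(μ,ε,χ)`. [cite: Liu21, Prop. 4.13] -/
theorem exists_mem_block_ne_zero_of_prop413 (h413 : D.Prop413) (μ : D.Char) (a : D.Adm μ) [Nontrivial (D.Ω μ a)] :
    ∃ x : D.H, x ∈ D.block μ ∧ x ≠ 0 := by
  haveI : Nontrivial (D.Ωt ⟨μ, a⟩) := ‹Nontrivial (D.Ω μ a)›
  obtain ⟨x, hx, hx0⟩ := (Submodule.ne_bot_iff _).1 (oscImage_ne_bot_of_prop413 D h413 ⟨μ, a⟩)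
  exact ⟨x, oscImage_le_block (D := D) ⟨μ, a⟩ hx, hx0⟩

end Summit.HodgeConjecture.CorCM.Transposition.BlockNonvanishing

end
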